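import Literature.AnabelianGeometry.SemiGraphs.ChartFibreProfiniteCompletion
import HarnessLib

/-!
# [SemiAnbd] Prop. 3.6 (iii): transport of the profinite-completion property to t1's basepoints
# through a vertex (`Π_𝒢 = Aut (ρ_v ⋙ forget)`), and along isomorphisms of topological groups

Mochizuki, *Semi-graphs of anabelioids*, Publ. RIMS **42** (2006), Prop. 3.6 (iii) p. 38 ("`π₁^temp(G) ↪
π̂₁(G)`") and Def. 2.1 p. 23 ("`Π_𝒢 := π̂₁(B(𝒢))` … natural outer homomorphisms `Π_v → Π_𝒢`")
[cite: MochizukiSemiAnbd2006, Prop 3.6(iii) p.38].  PROOF-ONLY sequel (abc-iut L3, B7d-bis) to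
`ChartFibreProfiniteCompletion.lean`:

* `IsProfiniteCompletion.of_mulEquiv` — GENERIC: the frozen predicate `IsProfiniteCompletion ι` is
  stable under composition with an isomorphism of topological groups `F̂ ≃ F̂'` (extensional form: any
  continuous `ι'` with `ι' x = e (ι x)`), so it does not depend on the model of `π̂₁`;
* `continuous_conjAut_of_natIso` — conjugation of automorphism groups along an isomorphism of
  `FintypeCat`-valued functors is continuous (evaluation topology; no Galois hypotheses);
* `isProfiniteCompletion_conjAut_chartActionFin` — hence, along `chartFibreFinIsoρ : chartFibreFin ≅
  ρ_v ⋙ forget` (a verticial homomorphism `ψ : Π_v → π₁^temp(𝒢)` with its defining isomorphism), the map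
  `π₁^temp(𝒢) → 𝒢.toAnab.Pi v (forget) = Aut (ρ_v ⋙ forget)`, `g ↦ j ∘ ι(g) ∘ j⁻¹`, to t1's basepoint
  of `B(𝒢)` THROUGH THE VERTEX `v` is again the profinite-completion map; `…_of_prop36` under
  `Prop36Hypotheses`.

No new definitions; nothing here takes a side on [IUTchIII] Cor. 3.12.
-/

noncomputable section

namespace Literature.AnabelianGeometry.SemiGraphs

open CategoryTheory CategoryTheory.Limits CategoryTheory.PreGaloisCategory
open Literature.AnabelianGeometry.Anabelioids
open Literature.AlgebraicGeometry.Frobenioids (BCat)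
open scoped FintypeCatDiscrete Pointwise
open _root_.Topology

universe u v w

/-! ### `IsProfiniteCompletion` is stable under isomorphisms of topological groups -/

namespace IsProfiniteCompletion

variable {F : Type u} {Fhat : Type v} {Fhat' : Type w} [Group F] [TopologicalSpace F]
  [Group Fhat] [TopologicalSpace Fhat] [Group Fhat'] [TopologicalSpace Fhat']

/-- **Transport of `IsProfiniteCompletion` along an isomorphism of topological groups** (extensional
form): if `ι : F → F̂` is the profinite completion and `e : F̂ ≃* F̂'` is a group isomorphism that is a
homeomorphism, then any continuous `ι' : F → F̂'` with `ι' = e ∘ ι` is the profinite completion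
([SemiAnbd] §6 p. 69: the profinite completion is well defined up to isomorphism).
[cite: MochizukiSemiAnbd2006, §6 p.69] -/
theorem of_mulEquiv {ι : F →ₜ* Fhat} (hι : IsProfiniteCompletion ι) (e : Fhat ≃* Fhat')
    (he : Continuous e) (he' : Continuous e.symm) (ι' : F →ₜ* Fhat')
    (hι' : ∀ x, ι' x = e (ι x)) : IsProfiniteCompletion ι' := by
  let eh : Fhat ≃ₜ Fhat' :=
    { toEquiv := e.toEquiv, continuous_toFun := he, continuous_invFun := he' }
  haveI := hι.compactSpace
  haveI := hι.t2Space
  haveI := hι.totallyDisconnectedSpace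
  have hfun : (ι' : F → Fhat') = e ∘ ι := funext hι'
  refine
    { compactSpace := eh.compactSpace
      t2Space := eh.t2Space
      totallyDisconnectedSpace := eh.totallyDisconnectedSpace
      denseRange := ?_
      comap_surjective := ?_
      isOpen_comap := ?_ }
  · rw [DenseRange, hfun]
    exact e.surjective.denseRange.comp hι.denseRange he
  · intro U hU
    obtain ⟨V, hV⟩ := hι.comap_surjective U hU
    haveI : V.toSubgroup.Normal := V.isNormal'
    refine ⟨{ toSubgroup := V.toSubgroup.comap e.symm.toMonoidHom,
              isOpen' := V.isOpen'.preimage he' }, ?_⟩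
    rw [hV]
    ext x
    simp only [Subgroup.mem_comap]
    change ι x ∈ V.toSubgroup ↔ e.symm (ι' x) ∈ V.toSubgroup
    rw [hι', MulEquiv.symm_apply_apply]
  · intro V
    exact V.isOpen'.preimage (map_continuous ι')

end IsProfiniteCompletion

/-! ### Conjugation along an isomorphism of `FintypeCat`-valued functors is continuous -/

/-- Conjugation `σ ↦ j⁻¹ ≫ σ ≫ j` of automorphisms along an isomorphism `j : Φ ≅ Φ'` of
`FintypeCat`-valued functors is CONTINUOUS for the evaluation topologies on `Aut Φ ⊆ ∏ Aut Φ(X)`,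
`Aut Φ' ⊆ ∏ Aut Φ'(X)` (it acts coordinatewise). [cite: MochizukiGeoAn2004, §1.1 p.10] -/
theorem continuous_conjAut_of_natIso {D : Type*} [Category D] {Φ Φ' : D ⥤ FintypeCat.{u}}
    (j : Φ ≅ Φ') : Continuous j.conjAut := by
  rw [(autEmbedding_isClosedEmbedding Φ').isInducing.continuous_iff, continuous_pi_iff]
  intro X
  have hco : (fun σ : Aut Φ => autEmbedding Φ' (j.conjAut σ) X) =
      fun σ => (j.app X).conjAut (autEmbedding Φ σ X) := by
    funext σ
    refine Iso.ext ?_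
    simp [Iso.conjAut_apply, autEmbedding_apply]
  change Continuous fun σ : Aut Φ => autEmbedding Φ' (j.conjAut σ) X
  rw [hco]
  exact continuous_of_discreteTopology.comp
    ((continuous_apply X).comp (autEmbedding_isClosedEmbedding Φ).continuous)

/-! ### Prop. 3.6 (iii) at t1's basepoint through a vertex -/

namespace ProfiniteSemiGraph

variable {𝒢 : ProfiniteSemiGraph.{u}}
variable (c : TemperedPiChart 𝒢) (h𝒢 : ∀ S : CovObj 𝒢, S.IsFinite → S.IsTempered)
variable (hfin : ∀ X : 𝒢.toAnab.BObj, Finite ((chartFibre c h𝒢).obj X))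

/-- **[SemiAnbd] Prop. 3.6 (iii) at the basepoint of `B(𝒢)` through a vertex.**  Along a verticial
homomorphism `ψ : Π_v → π₁^temp(𝒢)` with its defining isomorphism `e` (Thm. 3.7 (i)), the chart
basepoint is identified with t1's basepoint `ρ_v ⋙ forget` (`chartFibreFinIsoρ =: j`); the resulting
continuous homomorphism `π₁^temp(𝒢) → Π_𝒢 = 𝒢.toAnab.Pi v (forget) = Aut (ρ_v ⋙ forget)`,
`g ↦ j⁻¹⁻¹… = j.conjAut (chartActionFin g)`, exhibits `Π_𝒢` as THE PROFINITE COMPLETION of `π₁^temp(𝒢)`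
(`IsProfiniteCompletion`). [cite: MochizukiSemiAnbd2006, Prop 3.6(iii) p.38] -/
theorem isProfiniteCompletion_conjAut_chartActionFin (d : ChartVertexDatum c) (v : 𝒢.graph.Vertex)
    (ψ : 𝒢.Gv v →ₜ* c.G) (e : c.equiv.inverse ⋙ ObjectProperty.ι _ ⋙ restrictV 𝒢 v ≅ BTemp.res ψ) :
    IsProfiniteCompletion
      ({ toMonoidHom := (chartFibreFinIsoρ c h𝒢 hfin v ψ e).conjAut.toMonoidHom.comp
           (chartActionFin c h𝒢 hfin),
         continuous_toFun := (continuous_conjAut_of_natIso (chartFibreFinIsoρ c h𝒢 hfin v ψ e)).comp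
           (continuous_chartActionFin c h𝒢 hfin) } :
        c.G →ₜ* 𝒢.toAnab.Pi v
          (ObjectProperty.ι (Action.IsContinuous (V := FintypeCat.{u}) (G := 𝒢.Gv v)) ⋙
            Action.forget FintypeCat.{u} (𝒢.Gv v))) :=
  (isProfiniteCompletion_chartActionFin c h𝒢 hfin d).of_mulEquiv
    (chartFibreFinIsoρ c h𝒢 hfin v ψ e).conjAut
    (continuous_conjAut_of_natIso (chartFibreFinIsoρ c h𝒢 hfin v ψ e))
    (by
      have h : ((chartFibreFinIsoρ c h𝒢 hfin v ψ e).conjAut.symm : _ → _) =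
          (chartFibreFinIsoρ c h𝒢 hfin v ψ e).symm.conjAut := by
        funext σ
        apply (chartFibreFinIsoρ c h𝒢 hfin v ψ e).conjAut.injective
        rw [MulEquiv.apply_symm_apply]
        refine Iso.ext ?_
        simp [Iso.conjAut_apply]
      rw [h]
      exact continuous_conjAut_of_natIso (chartFibreFinIsoρ c h𝒢 hfin v ψ e).symm)
    _ (fun _ => rfl)

/-- The transported action on elements of a vertex fibre `X_v`: `(j ι(g) j⁻¹)_X y = j (ι(g) (j⁻¹ y))`;
for `g = ψ h`, `h ∈ Π_v`, this is the structure action `ρ(h)` on `X_v` (`chartFibreIsoρ_equivariant`).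
[cite: MochizukiSemiAnbd2006, Thm 3.7(i) p.40] -/
theorem conjAut_chartActionFin_hom_app_apply (v : 𝒢.graph.Vertex) (ψ : 𝒢.Gv v →ₜ* c.G)
    (e : c.equiv.inverse ⋙ ObjectProperty.ι _ ⋙ restrictV 𝒢 v ≅ BTemp.res ψ) (g : c.G)
    (X : 𝒢.toAnab.BObj) (y : (X.S v).obj.V) :
    ((chartFibreFinIsoρ c h𝒢 hfin v ψ e).conjAut (chartActionFin c h𝒢 hfin g)).hom.app X y =
      (chartFibreFinIsoρ c h𝒢 hfin v ψ e).hom.app X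
        ((chartActionFin c h𝒢 hfin g).hom.app X ((chartFibreFinIsoρ c h𝒢 hfin v ψ e).inv.app X y)) := by
  rw [Iso.conjAut_apply]
  rfl

/-- On the image of a verticial homomorphism the transported action IS the structure action of `Π_v`
on the vertex fibres: `(j ι(ψ h) j⁻¹)_X = ρ_{X_v}(h)` ([SemiAnbd] Thm. 3.7 (i): `ι ∘ ψ` is the natural
`Π_v → Π_𝒢`). [cite: MochizukiSemiAnbd2006, Thm 3.7(i) p.40] -/
theorem conjAut_chartActionFin_verticial_apply (v : 𝒢.graph.Vertex) (ψ : 𝒢.Gv v →ₜ* c.G)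
    (e : c.equiv.inverse ⋙ ObjectProperty.ι _ ⋙ restrictV 𝒢 v ≅ BTemp.res ψ) (h : 𝒢.Gv v)
    (X : 𝒢.toAnab.BObj) (y : (X.S v).obj.V) :
    ((chartFibreFinIsoρ c h𝒢 hfin v ψ e).conjAut (chartActionFin c h𝒢 hfin (ψ h))).hom.app X y =
      ConcreteCategory.hom ((X.S v).obj.ρ h) y := by
  rw [conjAut_chartActionFin_hom_app_apply]
  have h1 := chartFibreIsoρ_equivariant c h𝒢 v ψ e X h
    ((chartFibreFinIsoρ c h𝒢 hfin v ψ e).inv.app X y)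
  have h2 : (chartFibreFinIsoρ c h𝒢 hfin v ψ e).hom.app X
      ((chartFibreFinIsoρ c h𝒢 hfin v ψ e).inv.app X y) = y :=
    Iso.inv_hom_id_app_apply (chartFibreFinIsoρ c h𝒢 hfin v ψ e) X y
  rw [chartFibreFinIsoρ_hom_app_apply] at h2 ⊢
  rw [chartActionFin_hom_app_apply_eq, h1, h2]

/-- **Prop. 3.6 (iii) at t1's basepoint through a vertex, under `Prop36Hypotheses`**: for every chart
`c` and vertex `v` there are a verticial homomorphism `ψ : Π_v → π₁^temp(𝒢)` with defining
isomorphism `e` (Thm. 3.7 (i)) and a finiteness witness, for which `g ↦ j ι(g) j⁻¹ : π₁^temp(𝒢) →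
Aut (ρ_v ⋙ forget)` is the profinite-completion map. [cite: MochizukiSemiAnbd2006, Prop 3.6(iii) p.38] -/
theorem exists_isProfiniteCompletion_vertex (h36 : 𝒢.Prop36Hypotheses) (c : TemperedPiChart 𝒢)
    (v : 𝒢.graph.Vertex) :
    ∃ (ψ : 𝒢.Gv v →ₜ* c.G)
      (e : c.equiv.inverse ⋙ ObjectProperty.ι _ ⋙ restrictV 𝒢 v ≅ BTemp.res ψ)
      (hfin : ∀ X : 𝒢.toAnab.BObj,
        Finite ((chartFibre c (isTempered_of_isFinite_of_prop36 h36)).obj X)),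
      IsProfiniteCompletion
        ({ toMonoidHom :=
             (chartFibreFinIsoρ c (isTempered_of_isFinite_of_prop36 h36) hfin v ψ e).conjAut.toMonoidHom.comp
               (chartActionFin c (isTempered_of_isFinite_of_prop36 h36) hfin),
           continuous_toFun :=
             (continuous_conjAut_of_natIso
                 (chartFibreFinIsoρ c (isTempered_of_isFinite_of_prop36 h36) hfin v ψ e)).comp
               (continuous_chartActionFin c (isTempered_of_isFinite_of_prop36 h36) hfin) } :
          c.G →ₜ* 𝒢.toAnab.Pi v
            (ObjectProperty.ι (Action.IsContinuous (V := FintypeCat.{u}) (G := 𝒢.Gv v)) ⋙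
              Action.forget FintypeCat.{u} (𝒢.Gv v))) := by
  obtain ⟨ψ, ⟨e⟩⟩ := exists_isVerticialHom_of c v (TemperoidHomEqRes_holds (𝒢.Gv v) c.G)
    h36.isQuasiCoherent h36.isGaloisCountable
  let d : ChartVertexDatum c := ⟨h36.isConnected, v, ψ, e⟩
  have hfin : ∀ X : 𝒢.toAnab.BObj,
      Finite ((chartFibre c (isTempered_of_isFinite_of_prop36 h36)).obj X) :=
    fun X => finite_chartFibre c _ v ψ e X
  exact ⟨ψ, e, hfin, isProfiniteCompletion_conjAut_chartActionFin c _ hfin d v ψ e⟩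

end ProfiniteSemiGraph

end Literature.AnabelianGeometry.SemiGraphs

end
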